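/-
Copyright (c) 2026. All rights reserved.
Released under Apache 2.0 license as described in the file LICENSE.
Authors: abc-iut cell, seat abc-iut-L4-t9 (gen 4; block W2-B2, [AbsTopIII] Cor 3.7 — restriction of a
bi-anabelian setting to a full subcategory of `𝒳`, e.g. `𝒞^{MLF-sB} ⊆ 𝒞^{MLF}`).
-/
import Literature.AnabelianGeometry.AbsoluteAnabelian.AbsTopIII.BiAnabelianIncompatibilityProofs
import Mathlib.CategoryTheory.ObjectProperty.FullSubcategory
import HarnessLib

/-!
# [AbsTopIII] Cor 3.7: restricting the bi-anabelian setting to a full subcategory of `𝒳`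

S. Mochizuki, *Topics in absolute anabelian geometry III* [MochizukiAbsTopIII2015] (kurims manuscript
`paper:url-5493eb38cbb7`).  Cor 3.6 p. 78 / Cor 3.7 p. 86 are stated for `𝒳 = 𝒞^{MLF-sB}_{T𝔽}`, the
FULL SUBCATEGORY of `𝒞^{MLF}_{T𝔽}` "determined by the objects [...] of strictly Belyi type" (Def 3.1
(iii) p. 68: "we shall use the same notation, with 'MLF' replaced by MLF-hyp (respectively, MLF-sB;
MLF⊚) to denote the various full subcategories determined by the objects of hyperbolic orbicurve
type (respectively, of strictly Belyi type; of mono-analytic type)"), while the functors `log`,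
`λ^×`, `λ^{×pf}`, `ι_log`, `ι_×`, `(Π ↷ M) ↦ Π` of Def 3.1 (iii)/(iv) are defined on all of
`𝒞^{MLF}_{T𝔽}` and RESTRICTED ("the evident [...] restrictions", Cor 3.6 p. 79).

PROOF/CONSTRUCTION-ONLY companion of `MonoAnabelianComparisonMLF.lean` (abc-iut-L4-t9): for an
ABSTRACT setting `𝔖 : BiAnabelianSetting X E N` and any object property `P` of `𝒳` stable under
`log` (`P A → P (log A)`),

* `BiAnabelianSetting.restrict 𝔖 P hP : BiAnabelianSetting P.FullSubcategory E N` — the same data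
  with `𝒳` replaced by the full subcategory `{A | P A}` (all functors precomposed with the inclusion,
  `log` co-restricted, the 2-cells whiskered);
* `BiAnabelianSetting.logKernelObstruction_restrict` — the Lemma-3.4 obstruction (abc-iut-L4-t9's
  `LogKernelObstruction`, witnessed at an object `x₀`) passes to the restricted setting as soon as
  the witness `x₀` satisfies `P` (morphisms and the natural transformations are literally the same);
* `BiAnabelianSetting.incompatibleStmt_restrict` — hence Cor 3.7 (iv), first incompatibility, for the
  restricted setting (via `incompatibleStmt_of_obstruction`);
* `FiberSquare.inclPullback`, `FiberSquare.BiAnabelianLift.restrict` — the bi-anabelian lift datum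
  `θ^bi` of Cor 3.7 (ii) over `𝒳 ×_𝔈 𝒳` restricts to one over `{A | P A} ×_𝔈 {A | P A}`.

Use (the MODEL, other files): abc-iut-L4-t9 gen 3's `TFModel.modelSetting p` on the model category of
ALL model `TF`-pairs `(Π_k ↷ ℚ̄_p)` restricts to the full subcategory on slim `Π_k` (`TFModel.Slim p`,
id-rigid: `MLFGaloisModelIdRigid.lean`), where ALL residual inputs of Cor 3.7 except the lift datum
`θ^bi` of Cor 1.10 are then discharged.  Nothing here bears on [IUTchIII] Cor. 3.12.
-/

set_option autoImplicit false

namespace Literature.AnabelianGeometry.AbsoluteAnabelian.AbsTopIII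

open CategoryTheory CategoryTheory.Limits

universe u

namespace BiAnabelianSetting

/- One universe for objects and morphisms of `𝒳, 𝔈, 𝒩`, as in every Cor 3.7 statement file
(`BiAnabelianDiagrams`, `BiAnabelianIncompatibility`, ...): the full subcategory `{A | P A}` then has
the same shape (`Type u`, `Category.{u}`). -/
variable {X E N : Type u} [Category.{u} X] [Category.{u} E] [Category.{u} N]
  (𝔖 : BiAnabelianSetting X E N) (P : ObjectProperty X) (hP : ∀ A : X, P A → P (𝔖.log.obj A))

/-- **Restriction of a bi-anabelian setting to a `log`-stable full subcategory of `𝒳`** ("the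
evident restrictions" of `log`, `λ^×`, `λ^{×pf}` to `𝒞^{MLF-sB}_{T𝔽} ⊆ 𝒞^{MLF}_{T𝔽}`, Cor 3.6 p. 79 /
Cor 3.7 p. 86): `gal`, `λ^×`, `λ^{×pf}` precomposed with the inclusion `ι : {A | P A} ⥤ 𝒳`, `log`
co-restricted (it preserves `P` by `hP`), `log ≅ 𝟭`, `ι_log`, `ι_×` and the 2-cells over `𝔈` whiskered
by `ι`. [cite: MochizukiAbsTopIII2015, Cor 3.7 p.86] -/
def restrict : BiAnabelianSetting P.FullSubcategory E N where
  gal := P.ι ⋙ 𝔖.gal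
  log := P.lift (P.ι ⋙ 𝔖.log) fun A => hP A.obj A.property
  logIsoId := NatIso.ofComponents (fun A => P.isoMk (𝔖.logIsoId.app A.obj))
    (fun f => P.hom_ext (𝔖.logIsoId.hom.naturality f.hom))
  lamTimes := P.ι ⋙ 𝔖.lamTimes
  lamTimesPf := P.ι ⋙ 𝔖.lamTimesPf
  iotaLog :=
    { app := fun A => 𝔖.iotaLog.app A.obj
      naturality := fun _ _ f => 𝔖.iotaLog.naturality f.hom }
  iotaTimes := Functor.whiskerLeft P.ι 𝔖.iotaTimes
  spaceGal := 𝔖.spaceGal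
  lamTimesGal := Functor.isoWhiskerLeft P.ι 𝔖.lamTimesGal
  lamTimesPfGal := Functor.isoWhiskerLeft P.ι 𝔖.lamTimesPfGal

/-- The restricted `gal` is `(Π ↷ M) ↦ Π` on the subcategory. [cite: MochizukiAbsTopIII2015, Cor 3.7 p.86] -/
@[simp] theorem restrict_gal : (𝔖.restrict P hP).gal = P.ι ⋙ 𝔖.gal := rfl

/-- The restricted `log` on objects. [cite: MochizukiAbsTopIII2015, Cor 3.7 p.86] -/
@[simp] theorem restrict_log_obj (A : P.FullSubcategory) :
    ((𝔖.restrict P hP).log.obj A).obj = 𝔖.log.obj A.obj := rfl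

/-- The restricted `log` on morphisms. [cite: MochizukiAbsTopIII2015, Cor 3.7 p.86] -/
@[simp] theorem restrict_log_map {A B : P.FullSubcategory} (f : A ⟶ B) :
    ((𝔖.restrict P hP).log.map f).hom = 𝔖.log.map f.hom := rfl

/-- The restricted `λ^×`. [cite: MochizukiAbsTopIII2015, Cor 3.7 p.86] -/
@[simp] theorem restrict_lamTimes : (𝔖.restrict P hP).lamTimes = P.ι ⋙ 𝔖.lamTimes := rfl

/-- The restricted `λ^{×pf}`. [cite: MochizukiAbsTopIII2015, Cor 3.7 p.86] -/
@[simp] theorem restrict_lamTimesPf : (𝔖.restrict P hP).lamTimesPf = P.ι ⋙ 𝔖.lamTimesPf := rfl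

/-- The restricted `ι_log` has the same components. [cite: MochizukiAbsTopIII2015, Cor 3.7 p.86] -/
@[simp] theorem restrict_iotaLog_app (A : P.FullSubcategory) :
    (𝔖.restrict P hP).iotaLog.app A = 𝔖.iotaLog.app A.obj := rfl

/-- The restricted `ι_×` has the same components. [cite: MochizukiAbsTopIII2015, Cor 3.7 p.86] -/
@[simp] theorem restrict_iotaTimes_app (A : P.FullSubcategory) :
    (𝔖.restrict P hP).iotaTimes.app A = 𝔖.iotaTimes.app A.obj := rfl

/-- The restricted `log ≅ 𝟭` has the same components. [cite: MochizukiAbsTopIII2015, Cor 3.7 p.86] -/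
@[simp] theorem restrict_logIsoId_hom_app (A : P.FullSubcategory) :
    ((𝔖.restrict P hP).logIsoId.hom.app A).hom = 𝔖.logIsoId.hom.app A.obj := rfl

/-- **The Lemma-3.4 obstruction passes to the restriction** as soon as its witness lies in the
subcategory: if at `x₀` with `P x₀` no isomorphism `a : x₀ ⥲ log x₀` has `λ^×(a) ≫ ι_{log,x₀} = ι_{×,x₀}`
(for `𝒳 = 𝒞^{MLF}_{T𝔽}`: Lemma 3.4 p. 74, which holds at EVERY object), then the restricted setting
has the `LogKernelObstruction` (morphisms of the full subcategory are morphisms of `𝒳`, and an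
isomorphism there is an isomorphism in `𝒳`). [cite: MochizukiAbsTopIII2015, Cor 3.7 (iv) p.88] -/
theorem logKernelObstruction_restrict (x₀ : X) (hx₀ : P x₀)
    (h : ∀ a : x₀ ⟶ 𝔖.log.obj x₀, IsIso a →
      𝔖.lamTimes.map a ≫ 𝔖.iotaLog.app x₀ ≠ 𝔖.iotaTimes.app x₀) :
    (𝔖.restrict P hP).LogKernelObstruction := by
  refine ⟨⟨x₀, hx₀⟩, fun a ha => ?_⟩
  have ha' : IsIso a.hom := (P.isIso_hom_iff a).mpr ha
  exact h a.hom ha'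

/-- Conversely-shaped convenience: the obstruction of the AMBIENT setting, when it is known at a
specific object `x₀` of the subcategory, yields Cor 3.7 (iv)'s first incompatibility for the
restricted setting (abc-iut-L4-t9's `incompatibleStmt_of_obstruction`, which holds for every
setting). [cite: MochizukiAbsTopIII2015, Cor 3.7 (iv) p.88] -/
theorem incompatibleStmt_restrict (x₀ : X) (hx₀ : P x₀)
    (h : ∀ a : x₀ ⟶ 𝔖.log.obj x₀, IsIso a →
      𝔖.lamTimes.map a ≫ 𝔖.iotaLog.app x₀ ≠ 𝔖.iotaTimes.app x₀) :
    (𝔖.restrict P hP).IncompatibleStmt :=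
  (𝔖.restrict P hP).incompatibleStmt_of_obstruction (𝔖.logKernelObstruction_restrict P hP x₀ hx₀ h)

end BiAnabelianSetting

/-! ## Restricting a bi-anabelian lift datum `θ^bi` to a full subcategory -/

namespace FiberSquare

variable {X E : Type u} [Category.{u} X] [Category.{u} E] (Φ : X ⥤ E) (P : ObjectProperty X)

/-- The inclusion of fibre squares `{A | P A} ×_𝔈 {A | P A} ⥤ 𝒳 ×_𝔈 𝒳` induced by the full subcategory
inclusion (objects `(A₁, A₂, α)` with `P A₁, P A₂` and the same `α`). [cite: MochizukiAbsTopIII2015, Cor 3.7 (ii) p.87] -/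
@[simps]
def inclPullback : CategoricalPullback (P.ι ⋙ Φ) (P.ι ⋙ Φ) ⥤ CategoricalPullback Φ Φ where
  obj o := ⟨o.fst.obj, o.snd.obj, o.iso⟩
  map f := ⟨f.fst.hom, f.snd.hom, f.w⟩

namespace BiAnabelianLift

variable {Φ} (θ : BiAnabelianLift Φ)

/-- **A bi-anabelian lift datum restricts to every full subcategory of `𝒳`**: the lift
`θ^bi_{(A₁,A₂,α)} : A₁ ⥲ A₂` of an isomorphism of Galois data between objects of the subcategory is a
morphism of the (full) subcategory, still lying over `α` (Cor 3.7 (ii): `θ^bi` "arises from the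
functoriality [...] of the 'group-theoretic' algorithms of Corollary 1.10", applied to `𝒞^{MLF-sB}`).
[cite: MochizukiAbsTopIII2015, Cor 3.7 (ii) p.87] -/
def restrict : BiAnabelianLift (P.ι ⋙ Φ) where
  θbi := NatIso.ofComponents (fun o => P.isoMk (θ.θbi.app ((inclPullback Φ P).obj o)))
    (fun f => P.hom_ext (θ.θbi.hom.naturality ((inclPullback Φ P).map f)))
  map_θbi o := θ.map_θbi ((inclPullback Φ P).obj o)

/-- The restricted lift has the same components. [cite: MochizukiAbsTopIII2015, Cor 3.7 (ii) p.87] -/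
@[simp] theorem restrict_θbi_hom_app (o : CategoricalPullback (P.ι ⋙ Φ) (P.ι ⋙ Φ)) :
    ((θ.restrict P).θbi.hom.app o).hom = θ.θbi.hom.app ((inclPullback Φ P).obj o) := rfl

end BiAnabelianLift

end FiberSquare

end Literature.AnabelianGeometry.AbsoluteAnabelian.AbsTopIII
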